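import Mathlib
import Literature.Computability.AlgebraicComplexity.NonscalarComputation
import HarnessLib

/-!
# Quadratic parts of nonscalar computations and the rank bound `R ≤ 2 · L^{ns}`

Topic `Literature/Computability/AlgebraicComplexity`. Third support file for the formalisation of
Andrews 2022, Theorem 3 (`DeterminantalIdealComplexity.lean`): the algebraic core of Andrews'
Lemma 7 ("cf. [BCS97]": border multiplicative complexity and border rank of matrix multiplication
differ by at most a factor `2`), namely the classical comparison of the rank of a set of bilinear
forms with its nonscalar (multiplicative) complexity (Bürgisser–Clausen–Shokrollahi 1997,
Prop. (14.1) with Thm. (4.11)/(14.8): `L^{ns}(quadratic forms) = ` minimal number of products of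
linear forms; for bilinear forms every product of linear forms in all the variables splits into
`≤ 2` bilinear rank-one terms).

## Content

* `homogeneousComponent_two_mul_mem` — `(u v)₂ = u₀ v₂ + u₁ v₁ + u₂ v₀`: the quadratic part of a
  product lies in any submodule containing `u₂`, `v₂` and `u₁ · v₁`.
* `IsNonscalarSeq.exists_quadratic_forms` — for a nonscalar computation sequence of length `n`
  there are `n` pairs of LINEAR forms `(U_k, V_k)` such that the quadratic homogeneous part of
  every cost-free polynomial of the sequence is an `R`-linear combination of the `U_k · V_k`
  (BCS 1997, proof of Thm. (4.11) / Prop. (14.1): truncate the computation at degree `2`).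
* `coeff_mul_of_isHomogeneous_one` — for linear forms `U, V` and distinct variables `x ≠ y`:
  `coeff_{x y}(U V) = U_x V_y + U_y V_x`.
* `exists_triads_of_isNonscalarSeq` — if polynomials `p_o` (`o ∈ ο`) all lie in the cost-free
  span of ONE nonscalar computation sequence of length `≤ N`, then the 3-tensor of their bilinear
  coefficients `(o, a, b) ↦ coeff_{x_a y_b}(p_o)` (for two disjoint families of variables `x_a`,
  `y_b`) is a sum of `≤ 2N` triads (BCS 1997, Prop. (14.1) "`R ≤ 2 L`", with (14.8)).

Everything is over a commutative semiring; applied over `F((ε))` in the border setting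
(`NonscalarBorderRank.lean`).

## References

* [BurgisserClausenShokrollahi1997] P. Bürgisser, M. Clausen, M. A. Shokrollahi, *Algebraic
  Complexity Theory*, 1997, Thm. (4.11), Prop. (14.1), (14.8).
* [Andrews2022] R. Andrews, FOCS 2022, arXiv:2208.01078, Lemma 7.
-/

noncomputable section

open MvPolynomial

namespace Literature.Computability.AlgebraicComplexity

universe u v w w'

variable {R : Type u} [CommSemiring R] {σ : Type v}

/-! ### Quadratic parts -/

/-- The quadratic homogeneous part of a product `u · v` lies in every submodule containing the
quadratic parts of `u` and `v` and the product of their linear parts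
(`(uv)₂ = u₀ v₂ + u₁ v₁ + u₂ v₀`). [cite: BurgisserClausenShokrollahi1997, proof of Thm. (4.11)] -/
theorem homogeneousComponent_two_mul_mem {M : Submodule R (MvPolynomial σ R)}
    {u v : MvPolynomial σ R} (hu : homogeneousComponent 2 u ∈ M)
    (hv : homogeneousComponent 2 v ∈ M)
    (h11 : homogeneousComponent 1 u * homogeneousComponent 1 v ∈ M) :
    homogeneousComponent 2 (u * v) ∈ M := by
  classical
  have hprod : u * v = ∑ i ∈ Finset.range (u.totalDegree + 1),
      ∑ j ∈ Finset.range (v.totalDegree + 1),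
        homogeneousComponent i u * homogeneousComponent j v := by
    conv_lhs => rw [← sum_homogeneousComponent u, ← sum_homogeneousComponent v]
    rw [Finset.sum_mul_sum]
  rw [hprod, map_sum]
  refine Submodule.sum_mem _ fun i _ => ?_
  rw [map_sum]
  refine Submodule.sum_mem _ fun j _ => ?_
  have hmem : homogeneousComponent i u * homogeneousComponent j v ∈
      homogeneousSubmodule σ R (i + j) :=
    (mem_homogeneousSubmodule _ _).2
      ((homogeneousComponent_isHomogeneous i u).mul (homogeneousComponent_isHomogeneous j v))
  rw [homogeneousComponent_of_mem hmem]
  split_ifs with hij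
  · have hi : i ≤ 2 := by omega
    interval_cases i
    · obtain rfl : j = 2 := by omega
      rw [homogeneousComponent_zero, ← smul_eq_C_mul]
      exact M.smul_mem _ hv
    · obtain rfl : j = 1 := by omega
      exact h11
    · obtain rfl : j = 0 := by omega
      rw [homogeneousComponent_zero, mul_comm, ← smul_eq_C_mul]
      exact M.smul_mem _ hu
  · exact zero_mem _

/-- `1` has no quadratic part. [folklore] -/
theorem homogeneousComponent_two_one : homogeneousComponent 2 (1 : MvPolynomial σ R) = 0 :=
  homogeneousComponent_eq_zero _ _ (by simp)

/-- Variables have no quadratic part. [folklore] -/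
theorem homogeneousComponent_two_X (i : σ) :
    homogeneousComponent 2 (X i : MvPolynomial σ R) = 0 := by
  rw [homogeneousComponent_of_mem ((mem_homogeneousSubmodule _ _).2 (isHomogeneous_X R i))]
  simp

/-- The set of products of a list of pairs. [folklore] -/
def pairProducts (l : List (MvPolynomial σ R × MvPolynomial σ R)) : Set (MvPolynomial σ R) :=
  {q | ∃ uv ∈ l, q = uv.1 * uv.2}

/-- `pairProducts` of a longer list is larger. [folklore] -/
theorem pairProducts_mono_cons (a : MvPolynomial σ R × MvPolynomial σ R)
    (l : List (MvPolynomial σ R × MvPolynomial σ R)) : pairProducts l ⊆ pairProducts (a :: l) :=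
  fun _ ⟨uv, huv, hq⟩ => ⟨uv, List.mem_cons_of_mem _ huv, hq⟩

/-- `pairProducts l` is the range of `k ↦ l[k].1 * l[k].2`. [folklore] -/
theorem pairProducts_eq_range (l : List (MvPolynomial σ R × MvPolynomial σ R)) :
    pairProducts l = Set.range fun k : Fin l.length => (l.get k).1 * (l.get k).2 := by
  ext q
  simp only [pairProducts, Set.mem_setOf_eq, Set.mem_range]
  constructor
  · rintro ⟨uv, huv, rfl⟩
    obtain ⟨k, rfl⟩ := List.mem_iff_get.1 huv
    exact ⟨k, rfl⟩
  · rintro ⟨k, rfl⟩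
    exact ⟨l.get k, List.get_mem l k, rfl⟩

/-- **Degree-2 truncation of a nonscalar computation** (BCS 1997, proof of Thm. (4.11) and of
Prop. (14.1)): for a nonscalar computation sequence of length `n` there are `n` pairs of linear
forms `(U_k, V_k)` (the linear parts of the factors of the `n` products) such that the quadratic
part of every cost-free polynomial of the sequence is an `R`-linear combination of the products
`U_k V_k`. [cite: BurgisserClausenShokrollahi1997, Thm. (4.11) (proof)] -/
theorem IsNonscalarSeq.exists_quadratic_forms {gs : List (MvPolynomial σ R)}
    (h : IsNonscalarSeq gs) :
    ∃ l : List (MvPolynomial σ R × MvPolynomial σ R), l.length = gs.length ∧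
      (∀ uv ∈ l, uv.1.IsHomogeneous 1 ∧ uv.2.IsHomogeneous 1) ∧
      ∀ p ∈ freeSpan {x | x ∈ gs},
        homogeneousComponent 2 p ∈ Submodule.span R (pairProducts l) := by
  induction gs with
  | nil =>
    refine ⟨[], rfl, by simp, fun p hp => ?_⟩
    refine apply_mem_of_mem_freeSpan (homogeneousComponent 2) ?_ ?_ ?_ hp
    · rw [homogeneousComponent_two_one]
      exact zero_mem _
    · intro i
      rw [homogeneousComponent_two_X]
      exact zero_mem _
    · intro s hs
      simp at hs
  | cons g gs ih =>
    obtain ⟨hgs, u, hu, v, hv, rfl⟩ := h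
    obtain ⟨l, hlen, hhom, hspan⟩ := ih hgs
    refine ⟨(homogeneousComponent 1 u, homogeneousComponent 1 v) :: l, by simp [hlen], ?_,
      fun p hp => ?_⟩
    · intro uv huv
      rw [List.mem_cons] at huv
      rcases huv with rfl | huv
      · exact ⟨homogeneousComponent_isHomogeneous 1 u, homogeneousComponent_isHomogeneous 1 v⟩
      · exact hhom uv huv
    have hmono : Submodule.span R (pairProducts l) ≤
        Submodule.span R (pairProducts ((homogeneousComponent 1 u, homogeneousComponent 1 v) :: l)) :=
      Submodule.span_mono (pairProducts_mono_cons _ _)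
    refine apply_mem_of_mem_freeSpan (homogeneousComponent 2) ?_ ?_ ?_ hp
    · rw [homogeneousComponent_two_one]
      exact zero_mem _
    · intro i
      rw [homogeneousComponent_two_X]
      exact zero_mem _
    · intro s hs
      simp only [Set.mem_setOf_eq, List.mem_cons] at hs
      rcases hs with rfl | hs
      · refine homogeneousComponent_two_mul_mem (hmono (hspan u hu)) (hmono (hspan v hv)) ?_
        exact Submodule.subset_span ⟨_, List.mem_cons_self, rfl⟩
      · exact hmono (hspan s (mem_freeSpan_of_mem hs))

/-! ### Bilinear coefficients of products of linear forms -/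

/-- A monomial exponent of degree `1` is a single variable. [folklore] -/
theorem Finsupp.exists_eq_single_of_degree_eq_one {d : σ →₀ ℕ} (hd : Finsupp.degree d = 1) :
    ∃ z, d = Finsupp.single z 1 := by
  classical
  have hne : d ≠ 0 := by
    rintro rfl
    simp at hd
  obtain ⟨z, hz⟩ := Finsupp.ne_iff.1 hne
  simp only [Finsupp.coe_zero, Pi.zero_apply] at hz
  have hsplit := Finsupp.single_add_erase z d
  have hdeg : Finsupp.degree (Finsupp.single z (d z)) + Finsupp.degree (d.erase z) = 1 := by
    rw [← map_add, hsplit, hd]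
  rw [Finsupp.degree_single] at hdeg
  have hdz : d z = 1 := by omega
  have herase : Finsupp.degree (d.erase z) = 0 := by omega
  rw [Finsupp.degree_eq_zero_iff] at herase
  refine ⟨z, ?_⟩
  rw [← hsplit, herase, hdz, add_zero]

/-- **Bilinear coefficients of a product of linear forms**: for `U, V` homogeneous of degree `1`
and distinct variables `x ≠ y`, `coeff_{x·y}(U V) = U_x V_y + U_y V_x`, where `U_x` is the
coefficient of `x` in `U`. [cite: BurgisserClausenShokrollahi1997, (14.8)] -/
theorem coeff_mul_of_isHomogeneous_one [DecidableEq σ] {U V : MvPolynomial σ R}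
    (hU : U.IsHomogeneous 1) (hV : V.IsHomogeneous 1) {x y : σ} (hxy : x ≠ y) :
    coeff (Finsupp.single x 1 + Finsupp.single y 1) (U * V) =
      coeff (Finsupp.single x 1) U * coeff (Finsupp.single y 1) V +
        coeff (Finsupp.single y 1) U * coeff (Finsupp.single x 1) V := by
  set sx : σ →₀ ℕ := Finsupp.single x 1 with hsx
  set sy : σ →₀ ℕ := Finsupp.single y 1 with hsy
  have hne : (sx, sy) ≠ (sy, sx) := by
    intro h
    have h1 : sx = sy := (Prod.mk.inj h).1
    rw [hsx, hsy] at h1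
    exact hxy (Finsupp.single_left_injective (by norm_num) h1)
  rw [coeff_mul]
  have hsub : ({(sx, sy), (sy, sx)} : Finset ((σ →₀ ℕ) × (σ →₀ ℕ))) ⊆
      Finset.HasAntidiagonal.antidiagonal (sx + sy) := by
    intro p hp
    simp only [Finset.mem_insert, Finset.mem_singleton] at hp
    rw [Finset.HasAntidiagonal.mem_antidiagonal]
    rcases hp with rfl | rfl
    · rfl
    · exact add_comm _ _
  rw [← Finset.sum_subset hsub]
  · rw [Finset.sum_pair hne]
  · intro p hp hpn
    rw [Finset.HasAntidiagonal.mem_antidiagonal] at hp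
    by_contra hprod
    have hU0 : coeff p.1 U ≠ 0 := fun h0 => hprod (by rw [h0, zero_mul])
    have hV0 : coeff p.2 V ≠ 0 := fun h0 => hprod (by rw [h0, mul_zero])
    have hd1 : Finsupp.degree p.1 = 1 := by
      by_contra h
      exact hU0 (hU.coeff_eq_zero h)
    have hd2 : Finsupp.degree p.2 = 1 := by
      by_contra h
      exact hV0 (hV.coeff_eq_zero h)
    obtain ⟨z, hz⟩ := Finsupp.exists_eq_single_of_degree_eq_one hd1
    obtain ⟨w, hw⟩ := Finsupp.exists_eq_single_of_degree_eq_one hd2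
    rw [hz, hw, hsx, hsy] at hp
    rcases (Finsupp.single_add_single_eq_single_add_single one_ne_zero one_ne_zero).1 hp with
      ⟨rfl, rfl⟩ | ⟨-, rfl, rfl⟩ | ⟨h11, -, -⟩
    · exact hpn (by simp [Prod.ext_iff, hz, hw, hsx, hsy])
    · exact hpn (by simp [Prod.ext_iff, hz, hw, hsx, hsy])
    · norm_num at h11

/-! ### From one computation sequence to a triad decomposition of the bilinear coefficients -/

/-- **`R ≤ 2 · L^{ns}` (BCS 1997, Prop. (14.1) with (14.8); the algebraic core of Andrews 2022,
Lemma 7).** Let `x : α → σ` and `y : β → σ` be two families of variables with `x a ≠ y b`, and let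
`p_o` (`o ∈ ο`) be polynomials all lying in the cost-free span of one nonscalar computation
sequence of length `≤ N`. Then the 3-tensor of bilinear coefficients
`t(o, a, b) = coeff_{x_a y_b}(p_o)` is a sum of at most `2N` triads:
`t(o,a,b) = Σ_ρ w_ρ(o) u_ρ(a) v_ρ(b)`. [cite: BurgisserClausenShokrollahi1997, Prop. (14.1)] -/
theorem exists_triads_of_isNonscalarSeq [DecidableEq σ] {α : Type w} {β : Type w'} {ο : Type*}
    (x : α → σ) (y : β → σ) (hxy : ∀ a b, x a ≠ y b) {N : ℕ} (p : ο → MvPolynomial σ R)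
    (h : ∃ gs : List (MvPolynomial σ R), IsNonscalarSeq gs ∧ gs.length ≤ N ∧
      ∀ o, p o ∈ freeSpan {q | q ∈ gs}) :
    ∃ r : ℕ, r ≤ 2 * N ∧ ∃ (w : Fin r → ο → R) (u : Fin r → α → R) (v : Fin r → β → R),
      ∀ o a b, ∑ ρ, w ρ o * u ρ a * v ρ b =
        coeff (Finsupp.single (x a) 1 + Finsupp.single (y b) 1) (p o) := by
  classical
  obtain ⟨gs, hgs, hlen, hp⟩ := h
  obtain ⟨l, hl, hhom, hspan⟩ := hgs.exists_quadratic_forms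
  set n := l.length with hn
  -- coefficients of the quadratic parts in terms of the products `U_k V_k`
  have hc : ∀ o, ∃ c : Fin n → R,
      ∑ k, c k • ((l.get k).1 * (l.get k).2) = homogeneousComponent 2 (p o) := by
    intro o
    have hmem := hspan (p o) (hp o)
    rw [pairProducts_eq_range] at hmem
    exact (Submodule.mem_span_range_iff_exists_fun R).1 hmem
  choose c hc using hc
  -- the `2n` triads, indexed by `Fin n ⊕ Fin n`
  let U : Fin n → MvPolynomial σ R := fun k => (l.get k).1
  let V : Fin n → MvPolynomial σ R := fun k => (l.get k).2
  let w' : Fin n ⊕ Fin n → ο → R := fun ρ o => Sum.elim (fun k => c o k) (fun k => c o k) ρ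
  let u' : Fin n ⊕ Fin n → α → R := fun ρ a =>
    Sum.elim (fun k => coeff (Finsupp.single (x a) 1) (U k))
      (fun k => coeff (Finsupp.single (x a) 1) (V k)) ρ
  let v' : Fin n ⊕ Fin n → β → R := fun ρ b =>
    Sum.elim (fun k => coeff (Finsupp.single (y b) 1) (V k))
      (fun k => coeff (Finsupp.single (y b) 1) (U k)) ρ
  let e := finSumFinEquiv (m := n) (n := n)
  refine ⟨n + n, by omega, fun ρ => w' (e.symm ρ), fun ρ => u' (e.symm ρ), fun ρ => v' (e.symm ρ),
    fun o a b => ?_⟩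
  have hdeg : Finsupp.degree (Finsupp.single (x a) 1 + Finsupp.single (y b) 1) = 2 := by
    rw [map_add, Finsupp.degree_single, Finsupp.degree_single]
  calc ∑ ρ : Fin (n + n), w' (e.symm ρ) o * u' (e.symm ρ) a * v' (e.symm ρ) b
      = ∑ ρ : Fin n ⊕ Fin n, w' ρ o * u' ρ a * v' ρ b :=
        Fintype.sum_equiv e.symm _ _ fun _ => rfl
    _ = ∑ k : Fin n, c o k * (coeff (Finsupp.single (x a) 1) (U k) *
          coeff (Finsupp.single (y b) 1) (V k) +
            coeff (Finsupp.single (y b) 1) (U k) * coeff (Finsupp.single (x a) 1) (V k)) := by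
        rw [Fintype.sum_sum_type, ← Finset.sum_add_distrib]
        refine Finset.sum_congr rfl fun k _ => ?_
        simp only [w', u', v', Sum.elim_inl, Sum.elim_inr]
        ring
    _ = ∑ k : Fin n, c o k * coeff (Finsupp.single (x a) 1 + Finsupp.single (y b) 1)
          (U k * V k) := by
        refine Finset.sum_congr rfl fun k _ => ?_
        rw [coeff_mul_of_isHomogeneous_one (hhom _ (List.get_mem l k)).1
          (hhom _ (List.get_mem l k)).2 (hxy a b)]
    _ = coeff (Finsupp.single (x a) 1 + Finsupp.single (y b) 1)
          (∑ k : Fin n, c o k • (U k * V k)) := by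
        rw [coeff_sum]
        refine Finset.sum_congr rfl fun k _ => ?_
        rw [coeff_smul, smul_eq_mul]
    _ = coeff (Finsupp.single (x a) 1 + Finsupp.single (y b) 1) (homogeneousComponent 2 (p o)) := by
        rw [hc o]
    _ = coeff (Finsupp.single (x a) 1 + Finsupp.single (y b) 1) (p o) := by
        rw [coeff_homogeneousComponent, if_pos hdeg]

end Literature.Computability.AlgebraicComplexity
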